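import Literature.NumberTheory.Automorphic.LanglandsTunnellBridge
import Literature.NumberTheory.Automorphic.GodementJacquetPartialLProofs
import Literature.NumberTheory.Automorphic.AutomorphicRepsGLSatakeFlathProofs
import Literature.NumberTheory.Automorphic.PairLFunctionBaseChangeAutomorphic
import Literature.NumberTheory.Automorphic.AdelicGroupDataAutomorphicMeasureProofs
import HarnessLib

/-!
# Tunnell's bridge through the `L²` spine: Godement–Jacquet for `GL₂` + the `L²` realisation
(proofs; companion to `Literature.NumberTheory.Automorphic.LanglandsTunnellBridge` and
`Literature.NumberTheory.Automorphic.LanglandsTunnellCases`)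

`LanglandsTunnellBridge` proves the named fact
`Literature.NumberTheory.Automorphic.hasEntireContinuation_artinLFunction_of_isPiOfArtinRep`
(Tunnell, Bull. AMS 5 (1981), p. 173, ¶2: "When `π = π(ρ)` the L-series of `π` and `ρ` agree, and
since cuspidal representations have entire L-series, Artin's conjecture follows") from Artin's
functional equation (FE) and a hypothesis (JL) — the global Hecke theory of `GL(2)`
(Jacquet–Langlands, LNM 114 (1970), Thm. 11.1) written for the Borel–Jacquet carrier
`CuspidalAutomorphicRepData 2 F hcpt` of the fact and for *every* Satake family of `π`.  No unit
of the tree builds Hecke theory over that carrier: the tree's analytic theory of standard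
L-functions lives on the `L²` carrier `CuspidalAutomorphicRepGL n K μ` (irreducible closed
subrepresentations of `L²_cusp`), where "cuspidal representations of `GL_n`, `n ≥ 2`, have entire
standard L-functions, with a functional equation against the contragredient" is the named fact
`Literature.NumberTheory.Automorphic.godementJacquet` (**lang.S21**; Godement–Jacquet, LNM 260
(1972), Thm. 13.8; Jacquet, Corvallis (1979), Thm. (6.2)), and the passage between the two
carriers is Borel–Jacquet (1979), §4.6 (the named facts `AutomorphicRepsGL.exists_isAssociatedL2`,
`hasSatakeParamAt_iff_L2` of `AutomorphicRepsGL`, after the normalisation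
`π ↦ π ⊗ |det|^{-w}` making `A_G` act trivially, Borel–Jacquet (1979), 5.7).  This file re-routes
(JL) through that spine.  Everything here is a theorem; no definition, no named fact.

* `hasEntireContinuation_artinLFunction_of_isPiOfArtinRep_of_exists` (**proved**, the bridge for
  one `π`, existence form): if `L(s, ρ)` satisfies Artin's functional equation over `F`,
  `π = π(σ)` almost everywhere, and for *some* Satake family `α₀` of `π` at almost all places and
  *some* finite `S₀` the partial Euler products `L^{S₀}(s, α₀)`, `L^{S₀}(s, α₀⁻¹)` continue to
  entire functions from some right half-plane, then `L(s, σ)` is entire.  The reduction to the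
  form of `LanglandsTunnellBridge` uses the **proved** uniqueness of Satake parameters of
  Borel–Jacquet data (`AutomorphicRepData.hasSatakeParamAt_unique_holds`, Flath (1979), Thm. 3)
  and moves between exceptional sets by finitely many Euler polynomials, which are entire and
  non-zero far to the right (`exists_forall_eval_cpow_neg_ne_zero`,
  `partialStandardL_eq_prod_mul_of_subset`,
  `exists_differentiableOn_re_pos_of_entire_partialL_of_subset`).
* `exists_entire_partialL_of_godementJacquet` (**proved**, the `L²` side for `GL₂`):
  `godementJacquet` for `(2, K, μ)` gives, for every cuspidal `Π ≤ L²_cusp(GL₂)`, a finite `S₀`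
  and an honest Satake family `α₀` of `Π` off `S₀` with `L^{S₀}(s, α₀)` and `L^{S₀}(s, α₀⁻¹)`
  continuing to entire functions from a right half-plane: `L^{S}(s, Π) = L(s, Π) ∏_{v ∈ S} P_v(q_v^{-s})`
  with the true (here: existentially given) local factors `P_v`, which have constant term `1`
  (`StandardLFunctionData.L_eq_partialStandardL_mul_of_lt_re`, unconditional on `re s > n² + 2`);
  the contragredient `Π'` supplied by the functional-equation clause of `godementJacquet` has
  Satake family `α₀⁻¹` almost everywhere, and `godementJacquet` applied to `Π'` with the **proved**
  uniqueness of `L²` Satake parameters (`IsSatakeFamilyOf.eq_of_not_mem`, from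
  `Flath1979_heckeOperatorAt_ofLocal_eq_smul_holds`) gives the second continuation
  (Jacquet–Langlands 1970, Thm. 11.1: "`L(s, π)` and `L(s, π̃)` are entire").
* `partialStandardL_shift` (**proved**): `L^S(s, α · q^{-w}) = L^S(s + w, α)` — the partial
  L-function of a twist `π ⊗ |det|^w` (Bump 1997, §3.5, reduction to unitary central character).
* `exists_entire_partialL_of_transfer` (**proved**): if the `L²` Satake parameters of some
  cuspidal `Π` at almost every place are, after the shift by `q_v^{-w}`, Satake parameters of the
  Borel–Jacquet datum `π`, the existence-form (JL) passes from `Π` to `π`.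
* `hasEntireContinuation_artinLFunction_of_isPiOfArtinRep_of_godementJacquet` (**proved**, main):
  the bridge follows from (FE) for every number field, `godementJacquet` for `GL₂` over every
  number field and automorphic measure, and the transfer hypothesis `hT` — every cuspidal
  Borel–Jacquet datum `π` of `GL₂(𝔸_F)` has, up to a twist `|det|^w`, the Satake parameters of
  some cuspidal `Π ≤ L²_cusp(GL₂(𝔸_F) ⧸ A_G GL₂(F), μ)` at almost all places (Borel–Jacquet 1979,
  §4.6 with 5.7; in the tree: `cuspidal_W'_eq_bot`, the `A_G`-normalisation, then
  `AutomorphicRepsGL.exists_isAssociatedL2` and `hasSatakeParamAt_iff_L2`).  With it the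
  assembly `langlands_tunnell_hasEntireContinuation_of_cases_of_FE_of_GJ`.
* `hasEntireContinuation_artinLFunction_of_isPiOfArtinRep_of_godementJacquet_of_isAssociatedL2`
  (**proved**): the same with `hT` resolved into the two named bridge facts of `AutomorphicRepsGL`
  (`AutomorphicRepsGL.exists_isAssociatedL2`, `hasSatakeParamAt_iff_L2`, for `GL₂`), the
  **proved** existence of the automorphic measure
  (`AdelicGroupData.exists_isAutomorphicMeasure_gl_holds`) and the normalisation hypothesis
  `hN`: every cuspidal Borel–Jacquet datum of `GL₂` has, up to the shift `q_v^{-w}`, the Satake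
  parameters of an `A_G`-trivial one at almost every place (Borel–Jacquet 1979, 5.7)
  (`exists_transfer_of_isAssociatedL2`).

So `hasEntireContinuation_artinLFunction_of_isPiOfArtinRep_holds` is the last theorem applied to
`artin_functional_equation_holds`, `godementJacquet_holds (n := 2)`,
`AutomorphicRepsGL.exists_isAssociatedL2`/`hasSatakeParamAt_iff_L2` discharged, and the
`A_G`-normalisation of cuspidal Borel–Jacquet data — inputs that are each the business of other
parts of the tree (lang.S21 and its Godement–Jacquet decomposition; the `AutomorphicRepsGL…L2`
files; `AutomorphicRepDataSplitCenter`).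

## Mathlib / Literature search

Tree (`lean search`): `godementJacquet`, `StandardLFunctionData` (`.L`, `.localFactor`,
`L_eq_partialStandardL_mul_of_lt_re`), `multipliable_partialStandardL_of_lt_re`
(`SatakeParameterTrivialBound`), `partialStandardL_eq_prod_mul_partialStandardL`,
`differentiable_eval_eulerPolynomial_cpow_neg` (`GodementJacquetPartialL…`),
`AutomorphicRepData.hasSatakeParamAt_unique_holds` (`AutomorphicRepsGLSatakeFlathProofs`),
`IsSatakeFamilyOf.eq_of_not_mem` (`PairLFunctionBaseChangeAutomorphic`), and the
theorems of `LanglandsTunnellBridge`.  Mathlib: `Equiv.multipliable_iff`,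
`tendsto_rpow_atTop_of_base_lt_one`, `ContinuousAt.eventually_ne`.  Nothing is restated.

## References

* J. Tunnell, *Artin's conjecture for representations of octahedral type*, Bull. AMS (N.S.) 5
  (1981), 173–175: p. 173 ¶2. [Tunnell1981]
* H. Jacquet, R. P. Langlands, *Automorphic Forms on GL(2)*, LNM 114 (1970), §11, Thm. 11.1.
  [JacquetLanglands1970]
* R. Godement, H. Jacquet, *Zeta functions of simple algebras*, LNM 260 (1972), Thm. 13.8.
  [GodementJacquet1972]
* H. Jacquet, *Principal L-functions of the linear group*, Proc. Sympos. Pure Math. 33 (1979),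
  part 2, Thm. (6.2). [JacquetCorvallis1979]
* A. Borel, H. Jacquet, *Automorphic forms and automorphic representations*, Proc. Sympos. Pure
  Math. 33 (1979), part 1, §4.6, 5.7. [BorelJacquetCorvallis1979]
* D. Bump, *Automorphic Forms and Representations* (1997), §3.5. [Bump1997]
-/

noncomputable section

open scoped MatrixGroups NumberField Polynomial
open NumberField IsDedekindDomain Field Polynomial Complex Filter Topology MeasureTheory
open Literature.NumberTheory.GaloisRepresentations (ArtinRep FramedArtinRep)

namespace Literature.NumberTheory.Automorphic

/-! ### Euler polynomials far to the right; change of exceptional set -/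

section FarRight

variable {K : Type} [Field K] [NumberField K]

/-- A polynomial with non-zero constant term does not vanish at `q^{-s}` for `re s` large
(`q > 1`): `q^{-s} → 0` as `re s → ∞`, and the polynomial is continuous at `0`. [folklore] -/
theorem exists_forall_eval_cpow_neg_ne_zero_of_eval_zero_ne_zero (p : ℂ[X]) (hp : p.eval 0 ≠ 0)
    {q : ℕ} (hq : 1 < q) : ∃ x : ℝ, ∀ s : ℂ, x < s.re → p.eval ((q : ℂ) ^ (-s)) ≠ 0 := by
  have hq0 : (0 : ℝ) < q := by exact_mod_cast zero_lt_one.trans hq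
  have hev : ∀ᶠ z in 𝓝 (0 : ℂ), p.eval z ≠ 0 :=
    (p.continuous.continuousAt (x := 0)).eventually_ne hp
  obtain ⟨ε, hε, hball⟩ := Metric.eventually_nhds_iff.mp hev
  have ht : Tendsto (fun x : ℝ => ((q : ℝ)⁻¹) ^ x) atTop (𝓝 0) :=
    tendsto_rpow_atTop_of_base_lt_one _
      (by linarith [inv_pos.mpr hq0]) (inv_lt_one_of_one_lt₀ (by exact_mod_cast hq))
  obtain ⟨x, hx⟩ := Filter.eventually_atTop.mp (ht.eventually (gt_mem_nhds hε))
  refine ⟨x, fun s hs => hball ?_⟩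
  rw [dist_zero_right, norm_natCast_cpow_of_pos (zero_lt_one.trans hq), neg_re,
    Real.rpow_neg hq0.le, ← Real.inv_rpow hq0.le]
  exact hx s.re hs.le

/-- Finitely many polynomials with constant term `≠ 0` are simultaneously non-zero at
`q_v^{-s}` for `re s` large. [folklore] -/
theorem exists_forall_eval_cpow_neg_ne_zero (T : Finset (HeightOneSpectrum (𝓞 K)))
    (p : HeightOneSpectrum (𝓞 K) → ℂ[X]) (hp : ∀ v ∈ T, (p v).eval 0 ≠ 0) :
    ∃ x : ℝ, ∀ s : ℂ, x < s.re → ∀ v ∈ T, (p v).eval ((v.residueCard : ℂ) ^ (-s)) ≠ 0 := by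
  classical
  have key : ∀ v : HeightOneSpectrum (𝓞 K), ∃ x : ℝ, v ∈ T → ∀ s : ℂ, x < s.re →
      (p v).eval ((v.residueCard : ℂ) ^ (-s)) ≠ 0 := by
    intro v
    by_cases hv : v ∈ T
    · obtain ⟨x, hx⟩ := exists_forall_eval_cpow_neg_ne_zero_of_eval_zero_ne_zero (p v) (hp v hv)
        v.one_lt_residueCard
      exact ⟨x, fun _ => hx⟩
    · exact ⟨0, fun h => (hv h).elim⟩
  choose x hx using key
  refine ⟨∑ v ∈ T, |x v|, fun s hs v hv => hx v hv s (lt_of_le_of_lt ?_ hs)⟩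
  exact (le_abs_self _).trans (Finset.single_le_sum (fun u _ => abs_nonneg (x u)) hv)

/-- Polynomials in `q_v^{-s}` are entire. [folklore] -/
theorem differentiable_eval_cpow_neg_residueCard (p : ℂ[X]) (v : HeightOneSpectrum (𝓞 K)) :
    Differentiable ℂ fun s : ℂ => p.eval ((v.residueCard : ℂ) ^ (-s)) :=
  p.differentiable.comp (differentiable_id.neg.const_cpow
    (Or.inl (Nat.cast_ne_zero.mpr (zero_lt_one.trans v.one_lt_residueCard).ne')))

open scoped Classical in
/-- **Change of exceptional set.**  For finite `S₀ ⊆ S` and a point `s` where the Euler product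
of `α` off `S` is multipliable and the Euler polynomials `P_v = ∏_{a ∈ α v} (1 - a X)` at
`v ∈ S ∖ S₀` do not vanish at `q_v^{-s}`,
`L^S(s, α) = (∏_{v ∈ S ∖ S₀} P_v(q_v^{-s})) · L^{S₀}(s, α)`
(`partialStandardL_eq_prod_mul_partialStandardL` of `GodementJacquetPartialLProofs`, read
backwards; Jacquet–Shalika (1981), §1: partial L-functions for different `S` differ by finitely
many local factors).  `open scoped Classical` supplies `DecidableEq` for `S ∖ S₀`
(`HeightOneSpectrum` carries no instance). [folklore] -/
theorem partialStandardL_eq_prod_mul_of_subset {S₀ S : Finset (HeightOneSpectrum (𝓞 K))}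
    (h : S₀ ⊆ S) (α : SatakeFamily K) {s : ℂ}
    (hmul : Multipliable fun v : {v : HeightOneSpectrum (𝓞 K) // v ∉ (↑S : Set _)} =>
      ((eulerPolynomial (α v.1)).eval ((v.1.residueCard : ℂ) ^ (-s)))⁻¹)
    (hne : ∀ v ∈ S, v ∉ S₀ → (eulerPolynomial (α v)).eval ((v.residueCard : ℂ) ^ (-s)) ≠ 0) :
    partialStandardL ↑S α s =
      (∏ v ∈ S \ S₀, (eulerPolynomial (α v)).eval ((v.residueCard : ℂ) ^ (-s))) *
        partialStandardL ↑S₀ α s := by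
  classical
  have hT : ∀ v ∈ S \ S₀, v ∉ (↑S₀ : Set (HeightOneSpectrum (𝓞 K))) := fun v hv =>
    fun hv' => (Finset.mem_sdiff.mp hv).2 hv'
  have hE : (↑S₀ ∪ ↑(S \ S₀) : Set (HeightOneSpectrum (𝓞 K))) = ↑S := by
    ext v
    simp only [Set.mem_union, Finset.mem_coe, Finset.mem_sdiff]
    constructor
    · rintro (hv | ⟨hv, -⟩)
      · exact h hv
      · exact hv
    · intro hv
      by_cases hv0 : v ∈ S₀
      · exact Or.inl hv0
      · exact Or.inr ⟨hv, hv0⟩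
  -- transport multipliability along the set identity
  set f : HeightOneSpectrum (𝓞 K) → ℂ := fun v =>
    ((eulerPolynomial (α v)).eval ((v.residueCard : ℂ) ^ (-s)))⁻¹ with hf
  let e : {v : HeightOneSpectrum (𝓞 K) // v ∉ (↑S : Set _)} ≃
      {v : HeightOneSpectrum (𝓞 K) // v ∉ (↑S₀ ∪ ↑(S \ S₀) : Set _)} :=
    Equiv.subtypeEquivRight fun v => by rw [hE]
  have hmul' : Multipliable fun v : {v : HeightOneSpectrum (𝓞 K) //
      v ∉ (↑S₀ ∪ ↑(S \ S₀) : Set _)} => f v.1 := by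
    have h1 : Multipliable ((fun v : {v : HeightOneSpectrum (𝓞 K) //
        v ∉ (↑S₀ ∪ ↑(S \ S₀) : Set _)} => f v.1) ∘ e) := hmul
    exact (Equiv.multipliable_iff e).mp h1
  have htree := partialStandardL_eq_prod_mul_partialStandardL hT α hmul'
  have hE' : partialStandardL (↑S₀ ∪ ↑(S \ S₀)) α s = partialStandardL ↑S α s := by rw [hE]
  rw [hE'] at htree
  have hprod : ∏ v ∈ S \ S₀, (eulerPolynomial (α v)).eval ((v.residueCard : ℂ) ^ (-s)) ≠ 0 :=
    Finset.prod_ne_zero_iff.mpr fun v hv =>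
      hne v (Finset.mem_sdiff.mp hv).1 (Finset.mem_sdiff.mp hv).2
  rw [htree, ← mul_assoc, Finset.prod_inv_distrib, mul_inv_cancel₀ hprod, one_mul]

end FarRight

/-! ### Galois side: the analytic glue with a smaller exceptional set -/

section AnalyticGlue

variable {K : Type} [Field K] [NumberField K]
variable {V : Type*} [AddCommGroup V] [Module ℂ V] [TopologicalSpace V] [FiniteDimensional ℂ V]
  [IsModuleTopology ℂ V]

/-- **Continuation of an Artin L-function to `re s > 0` from an entire continuation of a
partial Euler product with fewer factors removed.**  As
`exists_differentiableOn_re_pos_of_entire_partialL` (`LanglandsTunnellBridge`), but the entire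
`g` is only required to continue `L^{S₀}(s, β₀)` for some `S₀ ⊆ S` and a family `β₀` agreeing
with `β` off `S`: then `g · ∏_{v ∈ S ∖ S₀} P_v(q_v^{-s})`, `P_v = ∏_{a ∈ β₀ v}(1 - a X)`, is
entire and continues `L^S(s, β)` (the Euler product of `ρ` is multipliable on `re s > 1`,
`multipliable_artinLFunction_holds`, so `L^S(s, β) = (∏_{v ∈ S ∖ S₀} P_v(q_v^{-s})) L^{S₀}(s, β₀)`
wherever the `P_v(q_v^{-s})` are non-zero, in particular far to the right).  Deligne–Serre
(1974), proof of Thm. 4.6 (iv): partial L-functions for different finite sets differ by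
finitely many entire factors. [cite: DeligneSerreASENS1974, proof of Thm. 4.6 (iv)] -/
theorem exists_differentiableOn_re_pos_of_entire_partialL_of_subset (ρ : ArtinRep K V)
    (S : Finset (HeightOneSpectrum (𝓞 K))) {β : SatakeFamily K} {d : ℕ}
    (hβ : ∀ v ∉ S, ∀ z : ℂ, (ρ.eulerFactorAt v).eval z = (eulerPolynomial (β v)).eval z)
    (hβ1 : ∀ v ∉ S, ∀ a ∈ β v, ‖a‖ ≤ 1) (hd : ∀ v ∉ S, Multiset.card (β v) ≤ d)
    {S₀ : Finset (HeightOneSpectrum (𝓞 K))} (hS₀ : S₀ ⊆ S) {β₀ : SatakeFamily K}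
    (hβ₀ : ∀ v ∉ S, β₀ v = β v) {g : ℂ → ℂ} (hg : Differentiable ℂ g) {x₀ : ℝ}
    (hgL : ∀ s : ℂ, x₀ < s.re → g s = partialStandardL (↑S₀) β₀ s) :
    ∃ E : ℂ → ℂ, DifferentiableOn ℂ E {s : ℂ | 0 < s.re} ∧
      ∀ s : ℂ, 1 < s.re → E s = GaloisRepresentations.artinLFunction ρ s := by
  classical
  -- non-vanishing of the finitely many Euler polynomials at `S \ S₀`, far to the right
  obtain ⟨x₁, hx₁⟩ := exists_forall_eval_cpow_neg_ne_zero (S \ S₀)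
    (fun v => eulerPolynomial (β₀ v))
    (fun v _ => by rw [eval_zero_eulerPolynomial]; exact one_ne_zero)
  -- multipliability of the `β₀`-factors off `S` on `re s > 1`, from the Artin Euler product
  have hmul : ∀ s : ℂ, 1 < s.re →
      Multipliable fun v : {v : HeightOneSpectrum (𝓞 K) // v ∉ (↑S : Set _)} =>
        ((eulerPolynomial (β₀ v.1)).eval ((v.1.residueCard : ℂ) ^ (-s)))⁻¹ := by
    intro s hs
    have hs0 : 0 < s.re := by linarith
    set f : HeightOneSpectrum (𝓞 K) → ℂ := fun v =>
      ((ρ.eulerFactorAt v).eval ((v.residueCard : ℂ) ^ (-s)))⁻¹ with hf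
    have hmult : Multipliable f := GaloisRepresentations.multipliable_artinLFunction_holds ρ hs
    have hene : ∀ v, (ρ.eulerFactorAt v).eval ((v.residueCard : ℂ) ^ (-s)) ≠ 0 := by
      intro v
      obtain ⟨α, -, hnorm, hα⟩ := ρ.exists_eval_eulerFactorAt_eq_eval_eulerPolynomial v
      rw [hα]
      refine eval_eulerPolynomial_ne_zero_of_norm_mul_lt_one fun a ha => ?_
      rw [norm_mul, norm_natCast_cpow_of_pos (zero_lt_one.trans v.one_lt_residueCard), neg_re,
        hnorm a ha, one_mul]
      exact Real.rpow_lt_one_of_one_lt_of_neg (by exact_mod_cast v.one_lt_residueCard)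
        (by linarith)
    have hunit : IsUnit (∏ v ∈ S, f v) :=
      isUnit_iff_ne_zero.mpr (Finset.prod_ne_zero_iff.mpr fun v _ => inv_ne_zero (hene v))
    refine (multipliable_compl_of_isUnit_prod S hmult hunit).congr fun v => ?_
    show (( ρ.eulerFactorAt v.1).eval ((v.1.residueCard : ℂ) ^ (-s)))⁻¹ = _
    rw [hβ v.1 v.2, hβ₀ v.1 v.2]
  -- the entire function continuing `L^S(s, β)`
  set X : ℝ := max (max 1 x₀) x₁ with hX
  have key : ∀ s : ℂ, X < s.re →
      g s * ∏ v ∈ S \ S₀, (eulerPolynomial (β₀ v)).eval ((v.residueCard : ℂ) ^ (-s)) =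
        partialStandardL (↑S) β s := by
    intro s hs
    have hs1 : 1 < s.re := lt_of_le_of_lt ((le_max_left _ _).trans (le_max_left _ _)) hs
    have hsx₀ : x₀ < s.re := lt_of_le_of_lt ((le_max_right _ _).trans (le_max_left _ _)) hs
    have hsx₁ : x₁ < s.re := lt_of_le_of_lt (le_max_right _ _) hs
    have hLβ : partialStandardL (↑S) β s = partialStandardL (↑S) β₀ s := by
      unfold partialStandardL
      exact tprod_congr fun v => by rw [hβ₀ v.1 v.2]
    rw [hgL s hsx₀, hLβ, partialStandardL_eq_prod_mul_of_subset hS₀ β₀ (hmul s hs1)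
      (fun v hv hv₀ => hx₁ s hsx₁ v (Finset.mem_sdiff.mpr ⟨hv, hv₀⟩)), mul_comm]
  refine exists_differentiableOn_re_pos_of_entire_partialL ρ S hβ hβ1 hd
    (g := fun s => g s * ∏ v ∈ S \ S₀, (eulerPolynomial (β₀ v)).eval ((v.residueCard : ℂ) ^ (-s)))
    (hg.mul (Differentiable.fun_finsetProd fun v _ =>
      differentiable_eval_cpow_neg_residueCard _ v)) (x₀ := X) key

end AnalyticGlue

/-! ### The bridge for one `π`, existence form -/

section OnePi

variable {F : Type} [Field F] [NumberField F]

/-- **Tunnell's bridge for one `π`, from (FE) over `F` and the existence form of (JL).**  Let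
`σ : Γ_F → GL_2(ℂ)` be a framed Artin representation whose L-function satisfies Artin's
functional equation (`artin_functional_equation` over `F`), `π` a cuspidal automorphic
representation of `GL_2(𝔸_F)` (Borel–Jacquet datum) with `π = π(σ)` almost everywhere, and
suppose (JL, Jacquet–Langlands 1970, Thm. 11.1, existence form): for some family `α₀` which is a
Satake parameter of `π` at almost every place and some finite `S₀`, the partial Euler products
`L^{S₀}(s, α₀)` and `L^{S₀}(s, α₀⁻¹)` continue to entire functions from a right half-plane.  Then
`L(s, σ)` is entire.  Proof: Satake parameters of `π` are unique
(`AutomorphicRepData.hasSatakeParamAt_unique_holds`), so `α₀` is the Frobenius-compatible family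
off a finite `S ⊇ S₀`; then `exists_differentiableOn_re_pos_of_entire_partialL_of_subset` for `σ`
and `σ^∨` and `ArtinRep.hasEntireContinuation_of_satisfiesFunctionalEquation`, exactly as in
`hasEntireContinuation_artinLFunction_of_isPiOfArtinRep_of`. [cite: Tunnell1981, p. 173]
[cite: JacquetLanglands1970, §11, Thm. 11.1] -/
theorem hasEntireContinuation_artinLFunction_of_isPiOfArtinRep_of_exists
    (hFE : artin_functional_equation (K := F)) (σ : FramedArtinRep F 2)
    {hcpt : isCompact_glFiniteIntegralLevel 2 F} (π : CuspidalAutomorphicRepData 2 F hcpt)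
    (hπ : IsPiOfArtinRep σ π.1)
    (hJL : ∃ (S₀ : Finset (HeightOneSpectrum (𝓞 F))) (α₀ : SatakeFamily F),
      (∀ᶠ v in cofinite, π.1.HasSatakeParamAt v (α₀ v)) ∧
      (∃ g : ℂ → ℂ, Differentiable ℂ g ∧ ∃ x₀ : ℝ, ∀ s : ℂ, x₀ < s.re →
        g s = partialStandardL ↑S₀ α₀ s) ∧
      (∃ g : ℂ → ℂ, Differentiable ℂ g ∧ ∃ x₀ : ℝ, ∀ s : ℂ, x₀ < s.re →
        g s = partialStandardL ↑S₀ (dualFamily α₀) s)) :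
    GaloisRepresentations.LFunction.HasEntireContinuation
      (GaloisRepresentations.artinLFunction σ.toArtinRep) := by
  classical
  obtain ⟨S₀, α₀, hα₀, ⟨g, hg, x₀, hgL⟩, ⟨g', hg', x₀', hg'L⟩⟩ := hJL
  -- the finite exceptional sets
  have hfin : {v : HeightOneSpectrum (𝓞 F) | ¬ FrobSatakeCompatibleAt σ π.1 v}.Finite :=
    Filter.eventually_cofinite.mp hπ
  have hfin₀ : {v : HeightOneSpectrum (𝓞 F) | ¬ π.1.HasSatakeParamAt v (α₀ v)}.Finite :=
    Filter.eventually_cofinite.mp hα₀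
  set S : Finset (HeightOneSpectrum (𝓞 F)) := (hfin.toFinset ∪ hfin₀.toFinset) ∪ S₀ with hS
  have hS₀S : S₀ ⊆ S := Finset.subset_union_right
  have hcomp : ∀ v ∉ S, FrobSatakeCompatibleAt σ π.1 v := fun v hv => by
    by_contra h
    exact hv (Finset.mem_union_left _ (Finset.mem_union_left _ (hfin.mem_toFinset.mpr h)))
  have hα₀S : ∀ v ∉ S, π.1.HasSatakeParamAt v (α₀ v) := fun v hv => by
    by_contra h
    exact hv (Finset.mem_union_left _ (Finset.mem_union_right _ (hfin₀.mem_toFinset.mpr h)))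
  -- the compatible Satake family off `S`
  let α : SatakeFamily F := fun v =>
    if h : FrobSatakeCompatibleAt σ π.1 v then h.choose else 0
  have hα : ∀ v ∉ S, π.1.HasSatakeParamAt v (α v) ∧ σ.IsUnramifiedAt v ∧
      σ.HasFrobCharpolyAt v (satakePolynomial (α v)) := fun v hv => by
    have h := hcomp v hv
    simp only [α, dif_pos h]
    exact h.choose_spec
  -- uniqueness of Satake parameters: `α₀ = α` off `S`
  have hα₀α : ∀ v ∉ S, α₀ v = α v := fun v hv =>
    AutomorphicRepData.hasSatakeParamAt_unique_holds π.1 (hα₀S v hv) (hα v hv).1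
  have hα₀α' : ∀ v ∉ S, dualFamily α₀ v = dualFamily α v := fun v hv => by
    rw [dualFamily_apply, dualFamily_apply, hα₀α v hv]
  -- Galois side: Euler factors of `σ` and `σ^∨` off `S`
  have hd : ∀ v ∉ S, Multiset.card (α v) ≤ 2 := fun v hv => (hα v hv).1.card_eq.le
  have hβ : ∀ v ∉ S, ∀ z : ℂ,
      (σ.toArtinRep.eulerFactorAt v).eval z = (eulerPolynomial (α v)).eval z :=
    fun v hv z => by
      rw [eulerFactorAt_eq_eulerPolynomial_of_hasFrobCharpolyAt σ (hα v hv).2.1 (hα v hv).2.2]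
  have hβ1 : ∀ v ∉ S, ∀ a ∈ α v, ‖a‖ ≤ 1 := fun v hv a ha =>
    (norm_eq_one_of_mem_of_hasFrobCharpolyAt σ (hα v hv).2.2 ha).le
  have hβ' : ∀ v ∉ S, ∀ z : ℂ,
      ((FramedArtinRep.toArtinRep (GaloisRepresentations.FramedRep.dual σ)).eulerFactorAt v).eval
        z = (eulerPolynomial (dualFamily α v)).eval z :=
    fun v hv z => by
      rw [dual_eulerFactorAt_eq_eulerPolynomial_of_hasFrobCharpolyAt σ (hα v hv).2.1
        (hα v hv).2.2, dualFamily_apply]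
  have hβ1' : ∀ v ∉ S, ∀ a ∈ dualFamily α v, ‖a‖ ≤ 1 := by
    intro v hv a ha
    rw [dualFamily_apply, Multiset.mem_map] at ha
    obtain ⟨b, hb, rfl⟩ := ha
    rw [norm_inv, norm_eq_one_of_mem_of_hasFrobCharpolyAt σ (hα v hv).2.2 hb, inv_one]
  have hd' : ∀ v ∉ S, Multiset.card (dualFamily α v) ≤ 2 := fun v hv => by
    rw [dualFamily_apply, Multiset.card_map]
    exact hd v hv
  -- continuations to `re s > 0` and the functional equation
  obtain ⟨E, hE, hEL⟩ :=
    exists_differentiableOn_re_pos_of_entire_partialL_of_subset σ.toArtinRep S hβ hβ1 hd hS₀S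
      hα₀α hg hgL
  obtain ⟨E', hE', hE'L⟩ :=
    exists_differentiableOn_re_pos_of_entire_partialL_of_subset
      (FramedArtinRep.toArtinRep (GaloisRepresentations.FramedRep.dual σ)) S hβ' hβ1' hd' hS₀S
      hα₀α' hg' hg'L
  exact GaloisRepresentations.ArtinRep.hasEntireContinuation_of_satisfiesFunctionalEquation
    (hFE σ) le_rfl (by norm_num) ⟨E, hE, hEL⟩ ⟨E', hE', hE'L⟩

end OnePi

/-! ### The `L²` side: Godement–Jacquet for `GL₂` in partial-`L` existence form -/

section LTwo

variable {n : ℕ} {K : Type} [Field K] [NumberField K]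
  {μ : Measure (AdelicGroupData.gl n K).automorphicQuotient}
  [(AdelicGroupData.gl n K).IsAutomorphicMeasure μ]

/-- **From an entire `L(s, Π)` to an entire partial L-function.**  If the standard L-function
`D.L` of a datum `D` of the cuspidal `Π ≤ L²_cusp(GL_n)` has entire continuation, then for every
finite `S₀ ⊇ D.S` and every family `β` agreeing with `D.α` off `S₀`, `L^{S₀}(s, β)` agrees far
to the right with an entire function, namely
`g₀(s) · ∏_{v ∈ D.S} P_v(q_v^{-s}) · ∏_{v ∈ S₀ ∖ D.S} ∏_{a ∈ D.α v}(1 - a q_v^{-s})` with `g₀` the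
continuation of `D.L`: on `re s > n² + 2` the full Euler product splits off `D.S`
(`L_eq_partialStandardL_mul_of_lt_re`) and `S₀ ∖ D.S` (`partialStandardL_eq_prod_mul_of_subset`
with `multipliable_partialStandardL_of_lt_re`), and the removed polynomials have constant term `1`
(`eval_zero_localFactor`), so they are non-zero far to the right.  (Godement–Jacquet 1972,
Thm. 13.8 with Thm. 3.3: `L^S(s, π) = L(s, π) ∏_{v ∈ S} L(s, π_v)⁻¹` is entire with `L(s, π)`.)
[cite: GodementJacquet1972, Thm. 13.8] -/
theorem StandardLFunctionData.exists_entire_eq_partialStandardL_of_hasEntireContinuation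
    {P : CuspidalAutomorphicRepGL n K μ} (D : StandardLFunctionData P)
    (hD : GaloisRepresentations.LFunction.HasEntireContinuation D.L)
    {S₀ : Finset (HeightOneSpectrum (𝓞 K))} (hS : D.S ⊆ S₀) {β : SatakeFamily K}
    (hβ : ∀ v ∉ S₀, β v = D.α v) :
    ∃ g : ℂ → ℂ, Differentiable ℂ g ∧ ∃ x₀ : ℝ, ∀ s : ℂ, x₀ < s.re →
      g s = partialStandardL ↑S₀ β s := by
  classical
  obtain ⟨g₀, hg₀, hg₀L⟩ := hD
  obtain ⟨x₁, hx₁⟩ := exists_forall_eval_cpow_neg_ne_zero D.S D.localFactor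
    (fun v _ => by rw [D.eval_zero_localFactor]; exact one_ne_zero)
  obtain ⟨x₂, hx₂⟩ := exists_forall_eval_cpow_neg_ne_zero (S₀ \ D.S)
    (fun v => eulerPolynomial (D.α v))
    (fun v _ => by rw [eval_zero_eulerPolynomial]; exact one_ne_zero)
  set X : ℝ := max (max ((n : ℝ) ^ 2 + 2) x₁) x₂ with hX
  refine ⟨fun s => (∏ v ∈ S₀ \ D.S, (eulerPolynomial (D.α v)).eval ((v.residueCard : ℂ) ^ (-s))) *
      ((∏ v ∈ D.S, (D.localFactor v).eval ((v.residueCard : ℂ) ^ (-s))) * g₀ s), ?_, X,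
    fun s hs => ?_⟩
  · exact (Differentiable.fun_finsetProd fun v _ =>
      differentiable_eval_cpow_neg_residueCard _ v).mul
      ((Differentiable.fun_finsetProd fun v _ =>
        differentiable_eval_cpow_neg_residueCard _ v).mul hg₀)
  · have hsn : (n : ℝ) ^ 2 + 2 < s.re :=
      lt_of_le_of_lt ((le_max_left _ _).trans (le_max_left _ _)) hs
    have hsx₁ : x₁ < s.re := lt_of_le_of_lt ((le_max_right _ _).trans (le_max_left _ _)) hs
    have hsx₂ : x₂ < s.re := lt_of_le_of_lt (le_max_right _ _) hs
    have hs1 : 1 < s.re := by nlinarith [sq_nonneg (n : ℝ)]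
    have h1 := D.L_eq_partialStandardL_mul_of_lt_re hsn
    have hmul : Multipliable fun v : {v : HeightOneSpectrum (𝓞 K) // v ∉ (↑S₀ : Set _)} =>
        ((eulerPolynomial (D.α v.1)).eval ((v.1.residueCard : ℂ) ^ (-s)))⁻¹ :=
      multipliable_partialStandardL_of_lt_re
        (D.isSatakeFamily.mono (Finset.coe_subset.mpr hS)) hsn
    have h2 := partialStandardL_eq_prod_mul_of_subset hS D.α hmul
      (fun v hv hv₀ => hx₂ s hsx₂ v (Finset.mem_sdiff.mpr ⟨hv, hv₀⟩))
    have h3 : partialStandardL ↑S₀ β s = partialStandardL ↑S₀ D.α s := by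
      unfold partialStandardL
      exact tprod_congr fun v => by rw [hβ v.1 v.2]
    have hPne : ∏ v ∈ D.S, (D.localFactor v).eval ((v.residueCard : ℂ) ^ (-s)) ≠ 0 :=
      Finset.prod_ne_zero_iff.mpr fun v hv => hx₁ s hsx₁ v hv
    beta_reduce
    rw [h3, h2, hg₀L s hs1, h1, ← mul_assoc (∏ v ∈ D.S, _) _ _, Finset.prod_inv_distrib,
      mul_inv_cancel₀ hPne, one_mul]

end LTwo

section LTwoGL2

variable {K : Type} [Field K] [NumberField K]
  {μ : Measure (AdelicGroupData.gl 2 K).automorphicQuotient}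
  [(AdelicGroupData.gl 2 K).IsAutomorphicMeasure μ]

/-- **Godement–Jacquet for `GL₂` in partial-`L` existence form** (the tree's rendering of
Jacquet–Langlands 1970, Thm. 11.1: "`L(s, π)` and `L(s, π̃)` are entire" for a constituent `π`
of the space of cusp forms on `GL₂`).  Granting `godementJacquet` for `(2, K, μ)`, every
cuspidal `Π ≤ L²_cusp(GL₂(𝔸_K) ⧸ A_G GL₂(K), μ)` has a finite `S₀` and an honest Satake family
`α₀` off `S₀` such that `L^{S₀}(s, α₀)` and `L^{S₀}(s, α₀⁻¹)` continue to entire functions from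
a right half-plane: `godementJacquet Π` gives a datum `D` with `L(s, Π) = D.L` entire and a
cuspidal `Π'` with a datum `D'`, `D'.α = D.α⁻¹` off `D.S ∪ D'.S`; `godementJacquet Π'` gives `D''`
with `D''.L` entire, and `D''.α = D'.α` off `D''.S ∪ D'.S` (uniqueness of `L²` Satake
parameters, `IsSatakeFamilyOf.eq_of_not_mem` of `PairLFunctionBaseChangeAutomorphic`, from
`Flath1979_heckeOperatorAt_ofLocal_eq_smul_holds`); take `S₀ = D.S ∪ D'.S ∪ D''.S`, `α₀ = D.α` and
`StandardLFunctionData.exists_entire_eq_partialStandardL_of_hasEntireContinuation` twice.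
[cite: JacquetLanglands1970, §11, Thm. 11.1] [cite: GodementJacquet1972, Thm. 13.8]
[cite: JacquetCorvallis1979, Thm. (6.2)] -/
theorem exists_entire_partialL_of_godementJacquet
    (hGJ : godementJacquet (n := 2) (K := K) (μ := μ)) (P : CuspidalAutomorphicRepGL 2 K μ) :
    ∃ (S₀ : Finset (HeightOneSpectrum (𝓞 K))) (α₀ : SatakeFamily K),
      IsSatakeFamilyOf P ↑S₀ α₀ ∧
      (∃ g : ℂ → ℂ, Differentiable ℂ g ∧ ∃ x₀ : ℝ, ∀ s : ℂ, x₀ < s.re →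
        g s = partialStandardL ↑S₀ α₀ s) ∧
      (∃ g : ℂ → ℂ, Differentiable ℂ g ∧ ∃ x₀ : ℝ, ∀ s : ℂ, x₀ < s.re →
        g s = partialStandardL ↑S₀ (dualFamily α₀) s) := by
  classical
  obtain ⟨D, hDL, P', D', A, A', hdual, -⟩ := hGJ P (Or.inl le_rfl)
  obtain ⟨D'', hD''L, -⟩ := hGJ P' (Or.inl le_rfl)
  refine ⟨D.S ∪ (D'.S ∪ D''.S), D.α, D.isSatakeFamily.mono (by simp), ?_, ?_⟩
  · exact D.exists_entire_eq_partialStandardL_of_hasEntireContinuation hDL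
      Finset.subset_union_left (fun v _ => rfl)
  · refine D''.exists_entire_eq_partialStandardL_of_hasEntireContinuation hD''L
      (Finset.subset_union_right.trans Finset.subset_union_right) (fun v hv => ?_)
    have hvD : v ∉ D.S := fun h => hv (Finset.mem_union_left _ h)
    have hvD' : v ∉ D'.S := fun h => hv (Finset.mem_union_right _ (Finset.mem_union_left _ h))
    have hvD'' : v ∉ D''.S := fun h =>
      hv (Finset.mem_union_right _ (Finset.mem_union_right _ h))
    have h1 : D'.α v = dualFamily D.α v := hdual v (by
      simp only [Set.mem_union, Finset.mem_coe, not_or]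
      exact ⟨hvD, hvD'⟩)
    have h2 : D''.α v = D'.α v :=
      IsSatakeFamilyOf.eq_of_not_mem D''.isSatakeFamily D'.isSatakeFamily
        (by simpa using hvD'') (by simpa using hvD')
    rw [← h1, h2]

end LTwoGL2

/-! ### Twists by `|det|^w`: shifting partial L-functions, and the transfer `L² → Borel–Jacquet` -/

section Transfer

variable {K : Type} [Field K] [NumberField K]

/-- **The partial L-function of a Tate twist is a shift**: if the Satake parameters are
multiplied by `q_v^{-w}` (the effect of `π ↦ π ⊗ |det|^w` on Satake parameters), then
`L^S(s, α · q^{-w}) = L^S(s + w, α)` identically (factor by factor,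
`(1 - a q_v^{-w} q_v^{-s}) = (1 - a q_v^{-(s + w)})`).  Bump 1997, §3.5 (reduction to unitary
central character by twisting). [cite: Bump1997, §3.5] -/
theorem partialStandardL_shift (S : Set (HeightOneSpectrum (𝓞 K))) (α : SatakeFamily K)
    (w s : ℂ) :
    partialStandardL S (fun v => (α v).map (· * (v.residueCard : ℂ) ^ (-w))) s =
      partialStandardL S α (s + w) := by
  unfold partialStandardL
  refine tprod_congr fun v => ?_
  have hq : (v.1.residueCard : ℂ) ≠ 0 :=
    Nat.cast_ne_zero.mpr (zero_lt_one.trans v.1.one_lt_residueCard).ne'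
  rw [eval_eulerPolynomial, eval_eulerPolynomial, Multiset.map_map]
  congr 2
  refine Multiset.map_congr rfl fun a _ => ?_
  simp only [Function.comp_apply]
  rw [neg_add, Complex.cpow_add _ _ hq, mul_assoc, mul_comm ((v.1.residueCard : ℂ) ^ (-w))]

/-- The dual family of a shifted family is the dual family shifted the other way:
`(α · q^{-w})⁻¹ = α⁻¹ · q^{-(-w)}`. [folklore] -/
theorem dualFamily_shift (α : SatakeFamily K) (w : ℂ) :
    dualFamily (fun v => (α v).map (· * (v.residueCard : ℂ) ^ (-w))) =
      fun v => (dualFamily α v).map (· * (v.residueCard : ℂ) ^ (-(-w))) := by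
  funext v
  rw [dualFamily_apply, dualFamily_apply, Multiset.map_map, Multiset.map_map]
  refine Multiset.map_congr rfl fun a _ => ?_
  simp only [Function.comp_apply]
  rw [mul_inv, Complex.cpow_neg _ (-w)]

/-- **Transfer of the existence-form (JL) from an `L²` realisation to a Borel–Jacquet datum, up
to a Tate twist.**  Let `π` be a cuspidal automorphic representation of `GL_2(𝔸_K)`
(Borel–Jacquet datum) and `Π ≤ L²_cusp` a cuspidal representation such that, at almost every place `v`, every
`L²` Satake parameter `β` of `Π` at `v` (with respect to some principal congruence level prime
to `v`) yields the Satake parameter `β · q_v^{-w}` of `π` at `v` (this is `π ≃ π₀ ⊗ |det|^w`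
with `π₀` the space of `K_∞`-finite smooth vectors of `Π`: Borel–Jacquet 1979, §4.6 and 5.7).
If `Π` has an honest Satake family `α₀` off a finite `S₀` with `L^{S₀}(s, α₀)`,
`L^{S₀}(s, α₀⁻¹)` continuing to entire functions from a right half-plane, then so does `π`, with
the family `α₀ · q^{-w}` (a Satake parameter of `π` almost everywhere) and the same `S₀`:
`L^{S₀}(s, α₀ q^{-w}) = L^{S₀}(s + w, α₀)`, `L^{S₀}(s, (α₀ q^{-w})⁻¹) = L^{S₀}(s - w, α₀⁻¹)`
(`partialStandardL_shift`). [cite: BorelJacquetCorvallis1979, §4.6] [cite: Bump1997, §3.5] -/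
theorem exists_entire_partialL_of_transfer {hcpt : isCompact_glFiniteIntegralLevel 2 K}
    (π : CuspidalAutomorphicRepData 2 K hcpt)
    {μ : Measure (AdelicGroupData.gl 2 K).automorphicQuotient}
    [(AdelicGroupData.gl 2 K).IsAutomorphicMeasure μ] (P : CuspidalAutomorphicRepGL 2 K μ) (w : ℂ)
    (hT : ∀ᶠ v in cofinite, ∀ β : Multiset ℂ,
      (∃ 𝔫 : Ideal (𝓞 K), 𝔫 ≠ 0 ∧ ¬ v.asIdeal ∣ 𝔫 ∧ ∃ ϖ : (v.adicCompletion K)ˣ,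
        HasSatakeParameterAt P.1 (principalCongruenceLevel 2 K 𝔫) v ϖ β) →
      π.1.HasSatakeParamAt v (β.map (· * (v.residueCard : ℂ) ^ (-w))))
    (hP : ∃ (S₀ : Finset (HeightOneSpectrum (𝓞 K))) (α₀ : SatakeFamily K),
      IsSatakeFamilyOf P ↑S₀ α₀ ∧
      (∃ g : ℂ → ℂ, Differentiable ℂ g ∧ ∃ x₀ : ℝ, ∀ s : ℂ, x₀ < s.re →
        g s = partialStandardL ↑S₀ α₀ s) ∧
      (∃ g : ℂ → ℂ, Differentiable ℂ g ∧ ∃ x₀ : ℝ, ∀ s : ℂ, x₀ < s.re →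
        g s = partialStandardL ↑S₀ (dualFamily α₀) s)) :
    ∃ (S₀ : Finset (HeightOneSpectrum (𝓞 K))) (α₁ : SatakeFamily K),
      (∀ᶠ v in cofinite, π.1.HasSatakeParamAt v (α₁ v)) ∧
      (∃ g : ℂ → ℂ, Differentiable ℂ g ∧ ∃ x₀ : ℝ, ∀ s : ℂ, x₀ < s.re →
        g s = partialStandardL ↑S₀ α₁ s) ∧
      (∃ g : ℂ → ℂ, Differentiable ℂ g ∧ ∃ x₀ : ℝ, ∀ s : ℂ, x₀ < s.re →
        g s = partialStandardL ↑S₀ (dualFamily α₁) s) := by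
  obtain ⟨S₀, α₀, hα₀, ⟨g, hg, x₀, hgL⟩, ⟨g', hg', x₀', hg'L⟩⟩ := hP
  refine ⟨S₀, fun v => (α₀ v).map (· * (v.residueCard : ℂ) ^ (-w)), ?_, ?_, ?_⟩
  · filter_upwards [hT, S₀.eventually_cofinite_notMem] with v hv hvS
    exact hv (α₀ v) (by
      obtain ⟨𝔫, h𝔫, hv𝔫, ϖ, hϖ⟩ := hα₀ v hvS
      exact ⟨𝔫, h𝔫, hv𝔫, ϖ, hϖ⟩)
  · refine ⟨fun s => g (s + w), hg.comp (differentiable_id.add_const w), x₀ - w.re,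
      fun s hs => ?_⟩
    rw [partialStandardL_shift]
    exact hgL (s + w) (by rw [add_re]; linarith)
  · refine ⟨fun s => g' (s + -w), hg'.comp (differentiable_id.add_const (-w)), x₀' + w.re,
      fun s hs => ?_⟩
    rw [dualFamily_shift, partialStandardL_shift]
    exact hg'L (s + -w) (by rw [add_re, neg_re]; linarith)

-- `AutomorphyDatum.gl` lives over the coefficient algebra `mixedSpace K`, whose instances need
-- classical decidability of real/complex places (as in `LanglandsTunnellArtinLeaves`).
open scoped Classical in
/-- **The transfer hypothesis for an `A_G`-trivial `π` from Borel–Jacquet's two bridge facts.**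
If `π` is associated with some `Π ≤ L²_cusp` (`AutomorphicRepsGL.exists_isAssociatedL2`, which
requires the forms of `π` to be invariant under the split centre `A_G`: Borel–Jacquet 1979, §4.6)
and the two notions of Satake parameter agree along the association (`hasSatakeParamAt_iff_L2`,
loc. cit.), then every `L²` Satake parameter of `Π` at any place is a Satake parameter of `π`
there (no twist, `w = 0`). [cite: BorelJacquetCorvallis1979, §4.6] -/
theorem exists_transfer_of_isAssociatedL2 {hcpt : isCompact_glFiniteIntegralLevel 2 K}
    {μ : Measure (AdelicGroupData.gl 2 K).automorphicQuotient}
    [(AdelicGroupData.gl 2 K).IsAutomorphicMeasure μ]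
    (hA : AutomorphicRepsGL.exists_isAssociatedL2 hcpt μ) (hL2 : hasSatakeParamAt_iff_L2 hcpt μ)
    (π : CuspidalAutomorphicRepData 2 K hcpt)
    (hπ : ∀ φ ∈ π.1.W, ∀ z ∈ (AdelicGroupData.gl 2 K).center', ∀ g, φ (z * g) = φ g) :
    ∃ P : CuspidalAutomorphicRepGL 2 K μ, ∀ (v : HeightOneSpectrum (𝓞 K)) (β : Multiset ℂ),
      (∃ 𝔫 : Ideal (𝓞 K), 𝔫 ≠ 0 ∧ ¬ v.asIdeal ∣ 𝔫 ∧ ∃ ϖ : (v.adicCompletion K)ˣ,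
        HasSatakeParameterAt P.1 (principalCongruenceLevel 2 K 𝔫) v ϖ β) →
      π.1.HasSatakeParamAt v β := by
  obtain ⟨P, hP⟩ := hA π hπ
  refine ⟨P, fun v β ⟨𝔫, h𝔫, hv, ϖ, hϖ⟩ => (hL2 hP v β).mpr ⟨𝔫, ϖ, h𝔫, hv, hϖ⟩⟩

end Transfer

/-! ### The bridge from (FE), Godement–Jacquet for `GL₂`, and the `L²` realisation -/

section Main

/-- **Tunnell's bridge from Artin's functional equation, Godement–Jacquet for `GL₂`, and the
`L²` realisation of cuspidal Borel–Jacquet data.**  Assume: (FE) `artin_functional_equation`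
over every number field (Neukirch VII (12.6)); (GJ) `godementJacquet` (lang.S21: the standard
L-function of a cuspidal `Π` of `GL_n`, `n ≥ 2`, is entire, with functional equation against
the contragredient; Godement–Jacquet 1972, Thm. 13.8; Jacquet 1979, Thm. (6.2); for `n = 2`
this is Jacquet–Langlands 1970, Thm. 11.1) for `n = 2` over every number field and every
automorphic measure; (T) every cuspidal automorphic representation `π` of `GL_2(𝔸_F)` in the
sense of Borel–Jacquet (a `(𝔤, K_∞) × GL_2(𝔸_F^∞)`-module datum realised on cusp forms) has, for
some automorphic measure `μ`, some cuspidal `Π ≤ L²_cusp(GL_2(𝔸_F) ⧸ A_G GL_2(F), μ)` and some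
`w ∈ ℂ`, the Satake parameters `t_{Π,v} q_v^{-w}` at almost every place (Borel–Jacquet 1979,
§4.6: cusp forms are square integrable modulo `A_G GL_2(F)` once `A_G` acts trivially, which a
twist by `|det|^{-w}` achieves, loc. cit. 5.7; the two notions of Satake parameter agree).  Then
`hasEntireContinuation_artinLFunction_of_isPiOfArtinRep` holds: `π = π(σ)` almost everywhere
forces `L(s, σ)` to be entire (Tunnell 1981, p. 173 ¶2).  Proof:
`exists_entire_partialL_of_godementJacquet`, `exists_entire_partialL_of_transfer`,
`hasEntireContinuation_artinLFunction_of_isPiOfArtinRep_of_exists`. [cite: Tunnell1981, p. 173]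
[cite: JacquetLanglands1970, §11, Thm. 11.1] [cite: GodementJacquet1972, Thm. 13.8]
[cite: BorelJacquetCorvallis1979, §4.6] [cite: NeukirchANT1999, VII §12, Thm. (12.6)] -/
theorem hasEntireContinuation_artinLFunction_of_isPiOfArtinRep_of_godementJacquet
    (hFE : ∀ (F : Type) [Field F] [NumberField F], artin_functional_equation (K := F))
    (hGJ : ∀ (F : Type) [Field F] [NumberField F]
      (μ : Measure (AdelicGroupData.gl 2 F).automorphicQuotient)
      [(AdelicGroupData.gl 2 F).IsAutomorphicMeasure μ], godementJacquet (n := 2) (K := F) (μ := μ))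
    (hT : ∀ {F : Type} [Field F] [NumberField F] (hcpt : isCompact_glFiniteIntegralLevel 2 F)
      (π : CuspidalAutomorphicRepData 2 F hcpt),
      ∃ (μ : Measure (AdelicGroupData.gl 2 F).automorphicQuotient)
        (_ : (AdelicGroupData.gl 2 F).IsAutomorphicMeasure μ) (P : CuspidalAutomorphicRepGL 2 F μ)
        (w : ℂ), ∀ᶠ v in cofinite, ∀ β : Multiset ℂ,
          (∃ 𝔫 : Ideal (𝓞 F), 𝔫 ≠ 0 ∧ ¬ v.asIdeal ∣ 𝔫 ∧ ∃ ϖ : (v.adicCompletion F)ˣ,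
            HasSatakeParameterAt P.1 (principalCongruenceLevel 2 F 𝔫) v ϖ β) →
          π.1.HasSatakeParamAt v (β.map (· * (v.residueCard : ℂ) ^ (-w)))) :
    hasEntireContinuation_artinLFunction_of_isPiOfArtinRep := by
  intro F _ _ σ hcpt π _ hπ
  obtain ⟨μ, hμ, P, w, hT'⟩ := hT hcpt π
  exact hasEntireContinuation_artinLFunction_of_isPiOfArtinRep_of_exists (hFE F) σ π hπ
    (exists_entire_partialL_of_transfer π P w hT'
      (exists_entire_partialL_of_godementJacquet (hGJ F μ) P))

open scoped Classical in
/-- **The same with the transfer hypothesis resolved into Borel–Jacquet's bridge facts and the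
`A_G`-normalisation.**  Assume (FE), (GJ) for `GL₂`, the two named bridge facts of
`AutomorphicRepsGL` for `GL₂` over every number field, level and automorphic measure —
`AutomorphicRepsGL.exists_isAssociatedL2` (an `A_G`-trivial cuspidal Borel–Jacquet datum is
associated with an irreducible closed subspace of `L²_cusp`) and `hasSatakeParamAt_iff_L2` (the
two notions of Satake parameter agree) — and the normalisation (N): every cuspidal Borel–Jacquet
datum `π` of `GL₂(𝔸_F)` has the Satake parameters, shifted by `q_v^{-w}` for some `w ∈ ℂ`, of an
`A_G`-trivial cuspidal datum `π₀` at almost every place (`π₀ = π ⊗ |det|^{-w}` on an irreducible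
summand: Borel–Jacquet 1979, 5.7 with §4.6; Arthur–Clozel 1989, Ch. 3, proof of Thm. 3.1).  Then
the bridge holds (the automorphic measure exists: `AdelicGroupData.exists_isAutomorphicMeasure_gl_holds`;
`exists_transfer_of_isAssociatedL2`; the previous theorem). [cite: Tunnell1981, p. 173]
[cite: BorelJacquetCorvallis1979, §4.6 and 5.7] [cite: GodementJacquet1972, Thm. 13.8] -/
theorem hasEntireContinuation_artinLFunction_of_isPiOfArtinRep_of_godementJacquet_of_isAssociatedL2
    (hFE : ∀ (F : Type) [Field F] [NumberField F], artin_functional_equation (K := F))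
    (hGJ : ∀ (F : Type) [Field F] [NumberField F]
      (μ : Measure (AdelicGroupData.gl 2 F).automorphicQuotient)
      [(AdelicGroupData.gl 2 F).IsAutomorphicMeasure μ], godementJacquet (n := 2) (K := F) (μ := μ))
    (hA : ∀ (F : Type) [Field F] [NumberField F] (hcpt : isCompact_glFiniteIntegralLevel 2 F)
      (μ : Measure (AdelicGroupData.gl 2 F).automorphicQuotient)
      [(AdelicGroupData.gl 2 F).IsAutomorphicMeasure μ], AutomorphicRepsGL.exists_isAssociatedL2 hcpt μ)
    (hL2 : ∀ (F : Type) [Field F] [NumberField F] (hcpt : isCompact_glFiniteIntegralLevel 2 F)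
      (μ : Measure (AdelicGroupData.gl 2 F).automorphicQuotient)
      [(AdelicGroupData.gl 2 F).IsAutomorphicMeasure μ], hasSatakeParamAt_iff_L2 hcpt μ)
    (hN : ∀ {F : Type} [Field F] [NumberField F] (hcpt : isCompact_glFiniteIntegralLevel 2 F)
      (π : CuspidalAutomorphicRepData 2 F hcpt),
      ∃ (π₀ : CuspidalAutomorphicRepData 2 F hcpt) (w : ℂ),
        (∀ φ ∈ π₀.1.W, ∀ z ∈ (AdelicGroupData.gl 2 F).center', ∀ g, φ (z * g) = φ g) ∧
        ∀ᶠ v in cofinite, ∀ β : Multiset ℂ, π₀.1.HasSatakeParamAt v β →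
          π.1.HasSatakeParamAt v (β.map (· * (v.residueCard : ℂ) ^ (-w)))) :
    hasEntireContinuation_artinLFunction_of_isPiOfArtinRep := by
  refine hasEntireContinuation_artinLFunction_of_isPiOfArtinRep_of_godementJacquet hFE hGJ
    @fun F _ _ hcpt π => ?_
  obtain ⟨π₀, w, h₀, hN'⟩ := hN hcpt π
  obtain ⟨μ, hμ⟩ := AdelicGroupData.exists_isAutomorphicMeasure_gl_holds 2 F
  obtain ⟨P, hP⟩ := exists_transfer_of_isAssociatedL2 (hA F hcpt μ) (hL2 F hcpt μ) π₀ h₀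
  refine ⟨μ, hμ, P, w, ?_⟩
  filter_upwards [hN'] with v hv β hβ
  exact hv β (hP v β hβ)

/-- **The target over `ℚ` from the three cases of strong Artin, (FE), Godement–Jacquet for `GL₂`
and the `L²` realisation** (`langlands_tunnell_hasEntireContinuation_of_cases` with
`hasEntireContinuation_artinLFunction_of_isPiOfArtinRep_of_godementJacquet`).
[cite: Tunnell1981, p. 173 and Theorem] [cite: LanglandsBaseChange1980, §3] -/
theorem langlands_tunnell_hasEntireContinuation_of_cases_of_FE_of_GJ
    (hd : strongArtin_of_isDihedralType) (ht : strongArtin_of_isTetrahedralType)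
    (ho : strongArtin_of_isOctahedralType)
    (hFE : ∀ (F : Type) [Field F] [NumberField F], artin_functional_equation (K := F))
    (hGJ : ∀ (F : Type) [Field F] [NumberField F]
      (μ : Measure (AdelicGroupData.gl 2 F).automorphicQuotient)
      [(AdelicGroupData.gl 2 F).IsAutomorphicMeasure μ], godementJacquet (n := 2) (K := F) (μ := μ))
    (hT : ∀ {F : Type} [Field F] [NumberField F] (hcpt : isCompact_glFiniteIntegralLevel 2 F)
      (π : CuspidalAutomorphicRepData 2 F hcpt),
      ∃ (μ : Measure (AdelicGroupData.gl 2 F).automorphicQuotient)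
        (_ : (AdelicGroupData.gl 2 F).IsAutomorphicMeasure μ) (P : CuspidalAutomorphicRepGL 2 F μ)
        (w : ℂ), ∀ᶠ v in cofinite, ∀ β : Multiset ℂ,
          (∃ 𝔫 : Ideal (𝓞 F), 𝔫 ≠ 0 ∧ ¬ v.asIdeal ∣ 𝔫 ∧ ∃ ϖ : (v.adicCompletion F)ˣ,
            HasSatakeParameterAt P.1 (principalCongruenceLevel 2 F 𝔫) v ϖ β) →
          π.1.HasSatakeParamAt v (β.map (· * (v.residueCard : ℂ) ^ (-w)))) :
    langlands_tunnell_hasEntireContinuation :=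
  langlands_tunnell_hasEntireContinuation_of_cases hd ht ho
    (hasEntireContinuation_artinLFunction_of_isPiOfArtinRep_of_godementJacquet hFE hGJ hT)

end Main

end Literature.NumberTheory.Automorphic

end
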